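import Summits.CriticalPhenomena.PercolationContinuityZ3.Theorems.Transplant.FKConnectivityAllQAntipodalAnd4Parallel
import HarnessLib

/-!
# Connectivity correlation inequalities for `φ_{w,q}`, every `q > 0` — file 29: `C_∞` at level 3 for the PATH `S = P₄` — the THETA JUNCTION
# IDENTITY (gluing a two-terminal network `R` across the MIDDLE pair `{b, c}`: AND-drift of the composite = nonnegative combination of the
# AND-drift of `M`, the `bc`-CONTRACTED AND-drift of `M`, and the Theorem-U drift of `R`)

Support file (`--supports stmt-CriticalPhenomena-4575`), FK sub-lane `prim-bschramm-fk-2` (gen 19) of the post-continuity programme; builds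
on p205010 (kernel theorem, internal audit signed; external expert review pending).  No definitions, no named facts, no sorries; standard axioms.

THE PROBLEM (FK-Q2 §26–27; memo `bschramm/FROM-fk-2-g18-AND-WORDHALL.md` §7A).  The AND-drift of the path `S = {ab, bc, cd}` on a graph `N`
against a test function `g` is `a_S(g) = ∑_{γ ⊆ N} 𝔞(γ) g(γ)`, `𝔞(γ) = q^{k(γ ∪ S) + k(N \ γ)} - q^{k((N \ γ) ∪ S) + k(γ)}`; Conjecture
`C_∞` for the AND type is `a_S(g) ≤ 0` (`g` increasing, `0 < q ≤ 1`).  Root the host `H ⊇ S` at the middle edge `bc`; in the SP tree of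
`H \ bc` (terminals `b, c`) the end edges meet at a SERIES root (file 27), at a PARALLEL root in different children (file 28), or — the case
left open by gen 18 ("theta": all sectioning LPs at the cuts `{b, m}` and three-part cuts were infeasible, kit j154008/j154244/j154605) —
inside ONE series child `A′(b,m)·A″(m,c)` of a parallel root whose other children form a two-terminal network `R` between `b` and `c`.
THIS FILE settles the theta case at the identity level by cutting at the MIDDLE PAIR `{b, c}` itself: `N = M ⊔ R` with `M` (carrying
`a, b, c, d`) and `R` supported on vertex sets meeting only inside `{b, c}`.  For `γ = γ_M ⊔ γ_R` write `G = k(γ_M)`, `Ḡ = k(γ̄_M)`,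
`K = k(γ_M ∪ S)`, `K̄ = k(γ̄_M ∪ S)`, `B = k(γ_M ∪ bc)`, `B̄ = k(γ̄_M ∪ bc)`, `ρ = k(γ_R)`, `ρ̄ = k(γ̄_R)`, `c_R = 1{b ↔ c in γ_R}`,
`c̄_R = 1{b ↔ c in γ̄_R}`, `c_M = 1{b ↔ c in γ_M}`.  Then (`and4_summand_theta`)
`q^{2|V|} 𝔞(γ) = (1-c̄_R) q^{ρ+ρ̄+c_R} (q^{K+Ḡ} - q^{K̄+G}) + c̄_R q^{ρ+ρ̄+1+c_R} (q^{K+B̄} - q^{K̄+B}) + (1-c_M)(q-1) q^{G+K̄} · q^{ρ+ρ̄}(c_R - c̄_R)`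
— `q^{K+Ḡ} - q^{K̄+G}` is the AND-summand of `M` itself, `q^{K+B̄} - q^{K̄+B}` the AND-summand of `M` WITH `bc` CONTRACTED (the |W| = 3 AND
of `{a, b=c, d}` on the minor `M/bc`), `q^{ρ+ρ̄}(c_R - c̄_R)` the Theorem-U summand of `R` (terminals `b, c`); all three multipliers have a
fixed sign for `0 < q ≤ 1` and depend only on the OTHER side.  The identity holds for EVERY `M` (found by a junction LP at the `{b,c}` cut —
kit j156070, feasible without slack at every `q` — and verified exactly on configurations; with `B = G - 1{b ↮ c in γ_M}` substituted it holds
with FREE exponents, so sixteen cases in the four indicators suffice).  Summing (`and4_theta_eq`) gives **`and4_theta_nonpos`** (the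
R-EXTENSION THEOREM): if the AND-drift and the `bc`-contracted AND-drift of `S` on `M` are `≤ 0` and `apUpc q R b c · ≥ 0` on monotone test
functions, then `a_S(g) ≤ 0` on `M ⊔ R` for every monotone `g` (`0 < q ≤ 1`).  For the theta junction `M = (A′ \ ab) ⊔_m (A″ \ cd)` the
first input is file 27's `and4_series_nonpos`, the second is gen 11's contracted two-edge theorem (`apPsiC_edge_nonpos_of_isTTSP` on the
re-rooted networks `A′ ∪ A″ ∪ {cb}`), the third is Theorem U on `R` — assembled in the sibling file 29a; with files 27a/28a this completes the
three junction types of `S = P₄`.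
[cite: Grimmett2006, §1.4 eq. (1.20) (p. 15); §3.8 Thm. (3.90) (pp. 61–62); §3.9 (pp. 63–64)] [cite: Wagner2006, Thm. 5.8(d), §5.3]
-/

noncomputable section

namespace Summit.CriticalPhenomena.PercolationContinuityZ3.Theorems

namespace FK

open SimpleGraph Literature.Probability.LatticeModels Literature.Probability.Percolation
open scoped Classical

variable {V : Type*} [Fintype V]

section Theta

variable {E₁ E₂ : Finset (Sym2 V)} {V₁ V₂ : Set V} {a b c d : V}

/-- **Theta junction, the `S`-side**: for `X ⊆ E₁ ⊇ S = {ab, bc, cd}` and `Y ⊆ E₂` (parts meeting only inside `{b, c}`, `b ≠ c`):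
`k(X ∪ S ∪ Y) + |V| = k(X ∪ S) + k(Y) + 1{b ↔ c in Y}` — the cross term of the parallel gluing is `1{b ↔ c in Y}` because `b ↔ c` in
`X ∪ S` through the edge `bc`. [cite: Grimmett2006, §3.8 (pp. 61–62)] -/
theorem clusterCount_junction_theta (h₁ : ∀ e ∈ (↑E₁ : Set (Sym2 V)), ∀ z ∈ e, z ∈ V₁)
    (h₂ : ∀ e ∈ (↑E₂ : Set (Sym2 V)), ∀ z ∈ e, z ∈ V₂) (hS : V₁ ∩ V₂ ⊆ {b, c}) (hbc : b ≠ c)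
    (hSE : ({s(a, b), s(b, c), s(c, d)} : Finset (Sym2 V)) ⊆ E₁) {X Y : Finset (Sym2 V)} (hX : X ⊆ E₁) (hY : Y ⊆ E₂) :
    clusterCount (↑(X ∪ {s(a, b), s(b, c), s(c, d)} ∪ Y) : BondConfig V) ∅ + Fintype.card V =
      clusterCount (↑(X ∪ {s(a, b), s(b, c), s(c, d)}) : BondConfig V) ∅ + clusterCount (↑Y : BondConfig V) ∅ +
        (if (openGraph (↑Y : BondConfig V)).Reachable b c then 1 else 0) := by
  have kpar := clusterCount_union_parallel h₁ h₂ hS hbc (Finset.union_subset hX hSE) hY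
  have hbcX : (openGraph (↑(X ∪ {s(a, b), s(b, c), s(c, d)}) : BondConfig V)).Reachable b c :=
    Adj.reachable ((fromEdgeSet_adj _).2 ⟨by
      rw [Finset.coe_union]
      exact Or.inr (Finset.mem_coe.2 (by simp only [Finset.mem_insert, Finset.mem_singleton, true_or, or_true])), hbc⟩)
  by_cases hY' : (openGraph (↑Y : BondConfig V)).Reachable b c
  · rw [if_pos ⟨hbcX, hY'⟩] at kpar; rw [if_pos hY']; exact kpar
  · rw [if_neg (fun h => hY' h.2)] at kpar; rw [if_neg hY']; exact kpar

set_option linter.unusedSimpArgs false in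
/-- **THE THETA JUNCTION IDENTITY (pointwise).**  For `N = M ⊔ R` glued inside `{b, c}` (`S = {ab, bc, cd}` on the `M`-side) and
`γ = γ_M ⊔ γ_R`, with `K = k(γ_M ∪ S)`, `K̄ = k(γ̄_M ∪ S)`, `G = k(γ_M)`, `Ḡ = k(γ̄_M)`, `B = k(γ_M ∪ bc)`, `B̄ = k(γ̄_M ∪ bc)`, `ρ = k(γ_R)`,
`ρ̄ = k(γ̄_R)`, `c_R = 1{b ↔ c in γ_R}`, `c̄_R = 1{b ↔ c in γ̄_R}`, `c_M = 1{b ↔ c in γ_M}`: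
`q^{2|V|} (q^{k(γ∪S)+k(γᶜ)} - q^{k(γᶜ∪S)+k(γ)}) = (1-c̄_R) q^{ρ+ρ̄+c_R} (q^{K+Ḡ} - q^{K̄+G}) + c̄_R q^{ρ+ρ̄+1+c_R} (q^{K+B̄} - q^{K̄+B})
  + (1-c_M) (q-1) q^{G+K̄} · q^{ρ+ρ̄} (c_R - c̄_R)` — sixteen cases in the four indicators `1{b ↔ c in ·}` of `γ_M, γ_Mᶜ, γ_R, γ_Rᶜ`.
[cite: Grimmett2006, §3.8 (pp. 61–62)] -/
theorem and4_summand_theta (q : ℝ) (h₁ : ∀ e ∈ (↑E₁ : Set (Sym2 V)), ∀ z ∈ e, z ∈ V₁)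
    (h₂ : ∀ e ∈ (↑E₂ : Set (Sym2 V)), ∀ z ∈ e, z ∈ V₂) (hS : V₁ ∩ V₂ ⊆ {b, c}) (hbc : b ≠ c)
    (hSE : ({s(a, b), s(b, c), s(c, d)} : Finset (Sym2 V)) ⊆ E₁)
    {M R γ δ : Finset (Sym2 V)} (hM : M ⊆ E₁) (hR : R ⊆ E₂) (hγ : γ ⊆ M) (hδ : δ ⊆ R) (x : ℝ) :
    q ^ (2 * Fintype.card V) *
        ((q ^ (clusterCount (↑(γ ∪ {s(a, b), s(b, c), s(c, d)} ∪ δ) : BondConfig V) ∅ +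
              clusterCount (↑((M \ γ) ∪ (R \ δ)) : BondConfig V) ∅) -
          q ^ (clusterCount (↑((M \ γ) ∪ {s(a, b), s(b, c), s(c, d)} ∪ (R \ δ)) : BondConfig V) ∅ +
              clusterCount (↑(γ ∪ δ) : BondConfig V) ∅)) * x) =
      (if (openGraph (↑(R \ δ) : BondConfig V)).Reachable b c then 0 else 1) *
          q ^ (clusterCount (↑δ : BondConfig V) ∅ + clusterCount (↑(R \ δ) : BondConfig V) ∅ +
            (if (openGraph (↑δ : BondConfig V)).Reachable b c then 1 else 0)) *
          ((q ^ (clusterCount (↑(γ ∪ {s(a, b), s(b, c), s(c, d)}) : BondConfig V) ∅ + clusterCount (↑(M \ γ) : BondConfig V) ∅) -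
            q ^ (clusterCount (↑((M \ γ) ∪ {s(a, b), s(b, c), s(c, d)}) : BondConfig V) ∅ + clusterCount (↑γ : BondConfig V) ∅)) * x) +
      (if (openGraph (↑(R \ δ) : BondConfig V)).Reachable b c then 1 else 0) *
          q ^ (clusterCount (↑δ : BondConfig V) ∅ + clusterCount (↑(R \ δ) : BondConfig V) ∅ + 1 +
            (if (openGraph (↑δ : BondConfig V)).Reachable b c then 1 else 0)) *
          ((q ^ (clusterCount (↑(γ ∪ {s(a, b), s(b, c), s(c, d)}) : BondConfig V) ∅ + clusterCount (↑((M \ γ) ∪ {s(b, c)}) : BondConfig V) ∅) -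
            q ^ (clusterCount (↑((M \ γ) ∪ {s(a, b), s(b, c), s(c, d)}) : BondConfig V) ∅ + clusterCount (↑(γ ∪ {s(b, c)}) : BondConfig V) ∅)) * x) +
      (if (openGraph (↑γ : BondConfig V)).Reachable b c then 0 else 1) * (q - 1) *
          q ^ (clusterCount (↑γ : BondConfig V) ∅ + clusterCount (↑((M \ γ) ∪ {s(a, b), s(b, c), s(c, d)}) : BondConfig V) ∅) *
          (q ^ apExp R δ * ((apConn δ b c - apConn (R \ δ) b c) * x)) := by
  -- junction bookkeeping for the four exponents of the left-hand side
  have eS := clusterCount_junction_theta h₁ h₂ hS hbc hSE (hγ.trans hM) (hδ.trans hR)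
  have eSb := clusterCount_junction_theta h₁ h₂ hS hbc hSE (Finset.sdiff_subset.trans hM) (Finset.sdiff_subset.trans hR)
    (X := M \ γ) (Y := R \ δ)
  have eC := clusterCount_union_parallel h₁ h₂ hS hbc (Finset.sdiff_subset.trans hM) (Finset.sdiff_subset.trans hR)
    (X := M \ γ) (Y := R \ δ)
  have eG := clusterCount_union_parallel h₁ h₂ hS hbc (hγ.trans hM) (hδ.trans hR) (X := γ) (Y := δ)
  -- the contracted atoms versus the free ones
  have b₁ := clusterCount_union_singleton_add_ite γ b c
  have bb₁ := clusterCount_union_singleton_add_ite (M \ γ) b c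
  unfold apExp apConn
  -- abbreviate the atoms
  set KSd := clusterCount (↑(γ ∪ {s(a, b), s(b, c), s(c, d)} ∪ δ) : BondConfig V) ∅
  set KSbd := clusterCount (↑((M \ γ) ∪ {s(a, b), s(b, c), s(c, d)} ∪ (R \ δ)) : BondConfig V) ∅
  set KC := clusterCount (↑((M \ γ) ∪ (R \ δ)) : BondConfig V) ∅
  set KG := clusterCount (↑(γ ∪ δ) : BondConfig V) ∅
  set KS := clusterCount (↑(γ ∪ {s(a, b), s(b, c), s(c, d)}) : BondConfig V) ∅
  set KSb := clusterCount (↑((M \ γ) ∪ {s(a, b), s(b, c), s(c, d)}) : BondConfig V) ∅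
  set G := clusterCount (↑γ : BondConfig V) ∅
  set Gb := clusterCount (↑(M \ γ) : BondConfig V) ∅
  set B := clusterCount (↑(γ ∪ {s(b, c)}) : BondConfig V) ∅
  set Bb := clusterCount (↑((M \ γ) ∪ {s(b, c)}) : BondConfig V) ∅
  set ρ := clusterCount (↑δ : BondConfig V) ∅
  set ρb := clusterCount (↑(R \ δ) : BondConfig V) ∅
  -- the left-hand side as one power
  have lhs1 : q ^ (2 * Fintype.card V) * q ^ (KSd + KC) = q ^ (KSd + Fintype.card V + (KC + Fintype.card V)) := by
    rw [← pow_add]; congr 1; omega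
  have lhs2 : q ^ (2 * Fintype.card V) * q ^ (KSbd + KG) = q ^ (KSbd + Fintype.card V + (KG + Fintype.card V)) := by
    rw [← pow_add]; congr 1; omega
  have expand : q ^ (2 * Fintype.card V) * ((q ^ (KSd + KC) - q ^ (KSbd + KG)) * x) =
      (q ^ (KSd + Fintype.card V + (KC + Fintype.card V)) - q ^ (KSbd + Fintype.card V + (KG + Fintype.card V))) * x := by
    rw [← lhs1, ← lhs2]; ring
  rw [expand, eS, eSb, eC, eG]
  by_cases r₁ : (openGraph (↑γ : BondConfig V)).Reachable b c <;>
  by_cases rb₁ : (openGraph (↑(M \ γ) : BondConfig V)).Reachable b c <;>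
  by_cases r₂ : (openGraph (↑δ : BondConfig V)).Reachable b c <;>
  by_cases rb₂ : (openGraph (↑(R \ δ) : BondConfig V)).Reachable b c <;>
  simp only [r₁, rb₁, r₂, rb₂, and_self, and_true, true_and, and_false, false_and, if_true, if_false,
    not_false_eq_true, not_true_eq_false, add_zero] at b₁ bb₁ ⊢ <;>
  (rw [← b₁, ← bb₁]; ring)

omit [Fintype V] in
/-- Regrouping the AND configuration of the theta junction: `(X ∪ Y) ∪ S = (X ∪ S) ∪ Y`. [folklore] -/
theorem union_union_path3_comm (X Y : Finset (Sym2 V)) (a b c d : V) :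
    X ∪ Y ∪ {s(a, b), s(b, c), s(c, d)} = X ∪ {s(a, b), s(b, c), s(c, d)} ∪ Y :=
  Finset.union_right_comm _ _ _

/-- **THE THETA JUNCTION IDENTITY (summed).**  For `N = M ⊔ R` glued inside `{b, c}` and `S = {ab, bc, cd}` on the `M`-side:
`q^{2|V|} · ∑_{γ ⊆ N} 𝔞(γ) g(γ)` is the sum over `γ_R ⊆ R` of nonnegative multiples of the AND functional of `M` and of its `bc`-contracted
AND functional (on the section `g(· ∪ γ_R)`), plus the sum over `γ_M ⊆ M` of nonpositive (`q ≤ 1`) multiples of the Theorem-U functional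
`apUpc q R b c (g(γ_M ∪ ·))`. [cite: Grimmett2006, §3.8 Thm. (3.90) (pp. 61–62)] -/
theorem and4_theta_eq (q : ℝ) (h₁ : ∀ e ∈ (↑E₁ : Set (Sym2 V)), ∀ z ∈ e, z ∈ V₁)
    (h₂ : ∀ e ∈ (↑E₂ : Set (Sym2 V)), ∀ z ∈ e, z ∈ V₂) (hS : V₁ ∩ V₂ ⊆ {b, c}) (hbc : b ≠ c)
    (hSE : ({s(a, b), s(b, c), s(c, d)} : Finset (Sym2 V)) ⊆ E₁)
    {M R : Finset (Sym2 V)} (hd : Disjoint M R) (hM : M ⊆ E₁) (hR : R ⊆ E₂) (g : Finset (Sym2 V) → ℝ) :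
    q ^ (2 * Fintype.card V) *
        ∑ γ ∈ (M ∪ R).powerset,
          (q ^ (clusterCount (↑(γ ∪ {s(a, b), s(b, c), s(c, d)}) : BondConfig V) ∅ + clusterCount (↑((M ∪ R) \ γ) : BondConfig V) ∅) -
              q ^ (clusterCount (↑((M ∪ R) \ γ ∪ {s(a, b), s(b, c), s(c, d)}) : BondConfig V) ∅ + clusterCount (↑γ : BondConfig V) ∅)) * g γ =
      ∑ δ ∈ R.powerset,
          ((if (openGraph (↑(R \ δ) : BondConfig V)).Reachable b c then 0 else 1) *
              q ^ (clusterCount (↑δ : BondConfig V) ∅ + clusterCount (↑(R \ δ) : BondConfig V) ∅ +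
                (if (openGraph (↑δ : BondConfig V)).Reachable b c then 1 else 0)) *
              ∑ γ ∈ M.powerset, (q ^ (clusterCount (↑(γ ∪ {s(a, b), s(b, c), s(c, d)}) : BondConfig V) ∅ + clusterCount (↑(M \ γ) : BondConfig V) ∅) -
                q ^ (clusterCount (↑((M \ γ) ∪ {s(a, b), s(b, c), s(c, d)}) : BondConfig V) ∅ + clusterCount (↑γ : BondConfig V) ∅)) * g (γ ∪ δ) +
            (if (openGraph (↑(R \ δ) : BondConfig V)).Reachable b c then 1 else 0) *
              q ^ (clusterCount (↑δ : BondConfig V) ∅ + clusterCount (↑(R \ δ) : BondConfig V) ∅ + 1 +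
                (if (openGraph (↑δ : BondConfig V)).Reachable b c then 1 else 0)) *
              ∑ γ ∈ M.powerset, (q ^ (clusterCount (↑(γ ∪ {s(a, b), s(b, c), s(c, d)}) : BondConfig V) ∅ + clusterCount (↑((M \ γ) ∪ {s(b, c)}) : BondConfig V) ∅) -
                q ^ (clusterCount (↑((M \ γ) ∪ {s(a, b), s(b, c), s(c, d)}) : BondConfig V) ∅ + clusterCount (↑(γ ∪ {s(b, c)}) : BondConfig V) ∅)) * g (γ ∪ δ)) +
        ∑ γ ∈ M.powerset,
          (if (openGraph (↑γ : BondConfig V)).Reachable b c then 0 else 1) * (q - 1) *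
            q ^ (clusterCount (↑γ : BondConfig V) ∅ + clusterCount (↑((M \ γ) ∪ {s(a, b), s(b, c), s(c, d)}) : BondConfig V) ∅) *
            apUpc q R b c (fun δ => g (γ ∪ δ)) := by
  unfold apUpc
  rw [Finset.mul_sum, sum_powerset_union_disj hd]
  simp_rw [Finset.mul_sum, ← Finset.sum_add_distrib]
  rw [Finset.sum_comm (s := R.powerset) (t := M.powerset), ← Finset.sum_add_distrib]
  refine Finset.sum_congr rfl fun γ hγ => ?_
  rw [← Finset.sum_add_distrib]
  refine Finset.sum_congr rfl fun δ hδ => ?_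
  rw [Finset.mem_powerset] at hγ hδ
  rw [union_sdiff_union hd hγ hδ, union_union_path3_comm, union_union_path3_comm,
    and4_summand_theta q h₁ h₂ hS hbc hSE hM hR hγ hδ (g (γ ∪ δ))]

/-- **THE R-EXTENSION THEOREM (AND for a 3-edge path across a theta junction, abstract form).**  Let `N = M ⊔ R` with the parts supported on
vertex sets meeting only inside `{b, c}` and `S = {ab, bc, cd}` on the `M`-side.  If (i) the AND-drift of `S` on `M` is `≤ 0` on every
monotone test function, (ii) the `bc`-CONTRACTED AND-drift of `S` on `M`
(`∑_{γ ⊆ M} (q^{k(γ∪S) + k((M\γ)∪bc)} - q^{k((M\γ)∪S) + k(γ∪bc)}) h(γ)`) is `≤ 0` on every monotone test function, and (iii) the Theorem-U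
functional of `R` with terminals `b, c` is `≥ 0` on every monotone test function, then the AND-drift of `S` on `N` is `≤ 0` on every monotone
`g` (`0 < q ≤ 1`).  For `M` = a series junction `(A′ \ ab) ⊔_m (A″ \ cd)` and `R` the remaining parallel children of `H \ bc` this is the
"theta" case of `C_∞(and_{P₄})`. [cite: Grimmett2006, §3.8 Thm. (3.90) (pp. 61–62)] -/
theorem and4_theta_nonpos {q : ℝ} (hq0 : 0 < q) (hq1 : q ≤ 1) (h₁ : ∀ e ∈ (↑E₁ : Set (Sym2 V)), ∀ z ∈ e, z ∈ V₁)
    (h₂ : ∀ e ∈ (↑E₂ : Set (Sym2 V)), ∀ z ∈ e, z ∈ V₂) (hS : V₁ ∩ V₂ ⊆ {b, c}) (hbc : b ≠ c)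
    (hSE : ({s(a, b), s(b, c), s(c, d)} : Finset (Sym2 V)) ⊆ E₁)
    {M R : Finset (Sym2 V)} (hd : Disjoint M R) (hM : M ⊆ E₁) (hR : R ⊆ E₂)
    (hA : ∀ h' : Finset (Sym2 V) → ℝ, (∀ ⦃A B : Finset (Sym2 V)⦄, A ⊆ B → B ⊆ M → h' A ≤ h' B) →
      ∑ γ ∈ M.powerset, (q ^ (clusterCount (↑(γ ∪ {s(a, b), s(b, c), s(c, d)}) : BondConfig V) ∅ + clusterCount (↑(M \ γ) : BondConfig V) ∅) -
        q ^ (clusterCount (↑((M \ γ) ∪ {s(a, b), s(b, c), s(c, d)}) : BondConfig V) ∅ + clusterCount (↑γ : BondConfig V) ∅)) * h' γ ≤ 0)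
    (hAc : ∀ h' : Finset (Sym2 V) → ℝ, (∀ ⦃A B : Finset (Sym2 V)⦄, A ⊆ B → B ⊆ M → h' A ≤ h' B) →
      ∑ γ ∈ M.powerset, (q ^ (clusterCount (↑(γ ∪ {s(a, b), s(b, c), s(c, d)}) : BondConfig V) ∅ + clusterCount (↑((M \ γ) ∪ {s(b, c)}) : BondConfig V) ∅) -
        q ^ (clusterCount (↑((M \ γ) ∪ {s(a, b), s(b, c), s(c, d)}) : BondConfig V) ∅ + clusterCount (↑(γ ∪ {s(b, c)}) : BondConfig V) ∅)) * h' γ ≤ 0)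
    (hU : ∀ h' : Finset (Sym2 V) → ℝ, (∀ ⦃A B : Finset (Sym2 V)⦄, A ⊆ B → B ⊆ R → h' A ≤ h' B) → 0 ≤ apUpc q R b c h')
    {g : Finset (Sym2 V) → ℝ} (hmono : ∀ ⦃A B : Finset (Sym2 V)⦄, A ⊆ B → B ⊆ M ∪ R → g A ≤ g B) :
    ∑ γ ∈ (M ∪ R).powerset,
        (q ^ (clusterCount (↑(γ ∪ {s(a, b), s(b, c), s(c, d)}) : BondConfig V) ∅ + clusterCount (↑((M ∪ R) \ γ) : BondConfig V) ∅) -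
            q ^ (clusterCount (↑((M ∪ R) \ γ ∪ {s(a, b), s(b, c), s(c, d)}) : BondConfig V) ∅ + clusterCount (↑γ : BondConfig V) ∅)) * g γ ≤ 0 := by
  have hpos : 0 < q ^ (2 * Fintype.card V) := pow_pos hq0 _
  have key := and4_theta_eq q h₁ h₂ hS hbc hSE hd hM hR g
  suffices hle : q ^ (2 * Fintype.card V) *
      ∑ γ ∈ (M ∪ R).powerset,
        (q ^ (clusterCount (↑(γ ∪ {s(a, b), s(b, c), s(c, d)}) : BondConfig V) ∅ + clusterCount (↑((M ∪ R) \ γ) : BondConfig V) ∅) -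
            q ^ (clusterCount (↑((M ∪ R) \ γ ∪ {s(a, b), s(b, c), s(c, d)}) : BondConfig V) ∅ + clusterCount (↑γ : BondConfig V) ∅)) * g γ ≤ 0 by
    by_contra hcon
    exact absurd hle (not_le.2 (mul_pos hpos (not_le.1 hcon)))
  rw [key]
  have hq1' : q - 1 ≤ 0 := by linarith
  have sec₁ : ∀ δ ∈ R.powerset, ∀ ⦃A B : Finset (Sym2 V)⦄, A ⊆ B → B ⊆ M → g (A ∪ δ) ≤ g (B ∪ δ) := by
    intro δ hδ A B hAB hB
    rw [Finset.mem_powerset] at hδ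
    exact hmono (Finset.union_subset_union hAB le_rfl) (Finset.union_subset_union hB hδ)
  have sec₂ : ∀ γ ∈ M.powerset, ∀ ⦃A B : Finset (Sym2 V)⦄, A ⊆ B → B ⊆ R → g (γ ∪ A) ≤ g (γ ∪ B) := by
    intro γ hγ A B hAB hB
    rw [Finset.mem_powerset] at hγ
    exact hmono (Finset.union_subset_union le_rfl hAB) (Finset.union_subset_union hγ hB)
  refine add_nonpos (Finset.sum_nonpos fun δ hδ => ?_) (Finset.sum_nonpos fun γ hγ => ?_)
  · have i₁ := hA (fun γ => g (γ ∪ δ)) (sec₁ δ hδ)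
    have i₂ := hAc (fun γ => g (γ ∪ δ)) (sec₁ δ hδ)
    refine add_nonpos (mul_nonpos_of_nonneg_of_nonpos (mul_nonneg ?_ (pow_nonneg hq0.le _)) i₁)
      (mul_nonpos_of_nonneg_of_nonpos (mul_nonneg ?_ (pow_nonneg hq0.le _)) i₂) <;>
    split_ifs <;> norm_num
  · have i₃ := hU (fun δ => g (γ ∪ δ)) (sec₂ γ hγ)
    have hc : (0 : ℝ) ≤ (if (openGraph (↑γ : BondConfig V)).Reachable b c then 0 else 1) := by split_ifs <;> norm_num
    have : (if (openGraph (↑γ : BondConfig V)).Reachable b c then (0 : ℝ) else 1) * (q - 1) *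
        q ^ (clusterCount (↑γ : BondConfig V) ∅ + clusterCount (↑((M \ γ) ∪ {s(a, b), s(b, c), s(c, d)}) : BondConfig V) ∅) ≤ 0 :=
      mul_nonpos_of_nonpos_of_nonneg (mul_nonpos_of_nonneg_of_nonpos hc hq1') (pow_nonneg hq0.le _)
    exact mul_nonpos_of_nonpos_of_nonneg this i₃

end Theta

end FK

end Summit.CriticalPhenomena.PercolationContinuityZ3.Theorems

end
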